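import Summits.ValiantsHypothesis.ValiantsHypothesis.Theorems.BarrierLeverPriorityPeelingLayoutSymmetry
import Summits.ValiantsHypothesis.ValiantsHypothesis.Theorems.BarrierLeverPriorityPeelingLayoutsSmallRank

/-!
# Route BarrierLever — conjecture TT (`TransversalMinorLayoutsNonsingular`, stmt-ValiantsHypothesis-19152):
# two free symmetries of the TT layout matrix — row/column swap and certificate transport

Helper file (`--supports stmt-ValiantsHypothesis-19152`; cell valiant-natproofs, rung V4, 𝒟-side of
door (c); seat val-np-p1 gen 8).  Conventions of item 19152 (row literal `castAdd a` / `natAdd a`,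
column literal `natAdd c` / `castAdd c`; GOOD = some `H` makes the layout matrix nonsingular).

* `tt_layout_swap`: GOOD`(w, u)` ⟹ GOOD`(u, w)` — the literal flip `castAdd ↔ natAdd` exchanges
  the row and column transversals of a point, so `(flip·H·flip)ᵀ` has the transposed layout matrix;
* `good_of_ppDerivable_relabel`: a priority-peeling derivation (`PriorityPeeling.PPDerivable`,
  prover gen 7, p460060) for ONE layout pair `(u₀, w₀)` gives GOOD for every injective pair whose
  row faces, relabeled by a coordinate permutation `π`, are faces of `u₀` and whose column faces,
  relabeled by `π'`, are faces of `w₀` (`PPSmall.ppDerivable_layout_symm` +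
  `PPSmall.exists_perm_of_forall_exists` + `alive_of_ppDerivable`).  This is how the kernel
  certificates for locked complex pairs are applied to all their placements.

WHAT THIS IS NOT: bookkeeping for bounded-rank slices of TT; nothing on TT / item 19761 in
general, on crux stmt-ValiantsHypothesis-14610, or on `VP` versus `VNP`.
-/

-- layout Summits/ValiantsHypothesis/ValiantsHypothesis forces the duplicated namespace component
set_option linter.dupNamespace false

open Matrix Finset

namespace Summit.ValiantsHypothesis.ValiantsHypothesis.Theorems.BarrierLever.FiniteCheck

open Summit.ValiantsHypothesis.ValiantsHypothesis.Theorems.BarrierLever.PriorityPeeling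

/-! ## 1. Two free symmetries: row/column swap and coordinate relabeling of a certificate -/

/-- ROW/COLUMN SWAP.  If the TT layout matrix of `(w, u)` is nonsingular for some `H`, so is that
of `(u, w)`: with the literal flip `castAdd a ↔ natAdd a` (which exchanges the row transversal and
the column transversal of a point), `H' := (flip·H·flip)ᵀ` has layout matrix the transpose of that
of `H`. -/
theorem tt_layout_swap (h r : ℕ) (u w : Fin r → Finset (Fin h))
    (hgood : ∃ H : Matrix (Fin (h + h)) (Fin (h + h)) ℂ, (Matrix.of fun i j : Fin r => (H.submatrix
      (fun a : Fin h => if a ∈ w i then Fin.castAdd h a else Fin.natAdd h a)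
      (fun c : Fin h => if c ∈ u j then Fin.natAdd h c else Fin.castAdd h c)).det).det ≠ 0) :
    ∃ H : Matrix (Fin (h + h)) (Fin (h + h)) ℂ, (Matrix.of fun i j : Fin r => (H.submatrix
      (fun a : Fin h => if a ∈ u i then Fin.castAdd h a else Fin.natAdd h a)
      (fun c : Fin h => if c ∈ w j then Fin.natAdd h c else Fin.castAdd h c)).det).det ≠ 0 := by
  classical
  obtain ⟨H, hH⟩ := hgood
  let flip : Equiv.Perm (Fin (h + h)) :=
    (finSumFinEquiv.symm.trans ((Equiv.sumComm (Fin h) (Fin h)).trans finSumFinEquiv))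
  have hflip1 : ∀ a : Fin h, flip (Fin.castAdd h a) = Fin.natAdd h a := by
    intro a
    simp only [flip, Equiv.trans_apply, finSumFinEquiv_symm_apply_castAdd, Equiv.sumComm_apply,
      Sum.swap_inl, finSumFinEquiv_apply_right]
  have hflip2 : ∀ a : Fin h, flip (Fin.natAdd h a) = Fin.castAdd h a := by
    intro a
    simp only [flip, Equiv.trans_apply, finSumFinEquiv_symm_apply_natAdd, Equiv.sumComm_apply,
      Sum.swap_inr, finSumFinEquiv_apply_left]
  refine ⟨(H.submatrix flip flip)ᵀ, ?_⟩
  have hM : (Matrix.of fun i j : Fin r => (((H.submatrix flip flip)ᵀ).submatrix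
      (fun a : Fin h => if a ∈ u i then Fin.castAdd h a else Fin.natAdd h a)
      (fun c : Fin h => if c ∈ w j then Fin.natAdd h c else Fin.castAdd h c)).det) =
      (Matrix.of fun i j : Fin r => (H.submatrix
        (fun a : Fin h => if a ∈ w i then Fin.castAdd h a else Fin.natAdd h a)
        (fun c : Fin h => if c ∈ u j then Fin.natAdd h c else Fin.castAdd h c)).det)ᵀ := by
    ext i j
    simp only [of_apply, transpose_apply]
    rw [← Matrix.det_transpose]
    congr 1
    ext c a
    simp only [transpose_apply, submatrix_apply]
    by_cases hc : c ∈ w j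
    · by_cases ha : a ∈ u i
      · rw [if_pos ha, if_pos hc, if_pos hc, if_pos ha, hflip1, hflip2]
      · rw [if_neg ha, if_pos hc, if_pos hc, if_neg ha, hflip2, hflip2]
    · by_cases ha : a ∈ u i
      · rw [if_pos ha, if_neg hc, if_neg hc, if_pos ha, hflip1, hflip1]
      · rw [if_neg ha, if_neg hc, if_neg hc, if_neg ha, hflip1, hflip2]
  rw [hM, Matrix.det_transpose]
  exact hH

/-- CERTIFICATE TRANSPORT.  A priority-peeling derivation for a layout pair `(u₀, w₀)` gives the
TT conclusion for every injective pair `(u, w)` whose row faces, relabeled by a coordinate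
permutation `π`, are faces of `u₀`, and whose column faces, relabeled by `π'`, are faces of `w₀`
(`PPSmall.exists_perm_of_forall_exists` for the re-indexings, `PPSmall.ppDerivable_layout_symm`
for the transport, `alive_of_ppDerivable` for soundness). -/
theorem good_of_ppDerivable_relabel {h r : ℕ} (u w u₀ w₀ : Fin r → Finset (Fin h))
    (hu : Function.Injective u) (hw : Function.Injective w) (π π' : Equiv.Perm (Fin h))
    (hiu : ∀ i, ∃ i', (u i).map π.toEmbedding = u₀ i')
    (hiw : ∀ j, ∃ j', (w j).map π'.toEmbedding = w₀ j')
    (h₀ : PPDerivable (h + h) (h + h) (Fin r) h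
      (fun i a => if a ∈ u₀ i then Fin.castAdd h a else Fin.natAdd h a)
      (fun j c => if c ∈ w₀ j then Fin.natAdd h c else Fin.castAdd h c)) :
    ∃ H : Matrix (Fin (h + h)) (Fin (h + h)) ℂ, (Matrix.of fun i j : Fin r => (H.submatrix
      (fun a : Fin h => if a ∈ u i then Fin.castAdd h a else Fin.natAdd h a)
      (fun c : Fin h => if c ∈ w j then Fin.natAdd h c else Fin.castAdd h c)).det).det ≠ 0 := by
  classical
  have hinju : Function.Injective (fun i => (u i).map π.toEmbedding) :=
    fun i j hij => hu (Finset.map_injective _ hij)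
  have hinjw : Function.Injective (fun j => (w j).map π'.toEmbedding) :=
    fun i j hij => hw (Finset.map_injective _ hij)
  obtain ⟨σ, hσ⟩ := PPSmall.exists_perm_of_forall_exists hiu hinju
  obtain ⟨τ, hτ⟩ := PPSmall.exists_perm_of_forall_exists hiw hinjw
  refine alive_of_ppDerivable (PPSmall.ppDerivable_layout_symm h r u w u₀ w₀ π π' ∅ ∅ σ τ ?_ ?_ h₀)
  · intro i b
    have e : π b ∈ u₀ (σ i) ↔ b ∈ u i := by
      rw [← hσ i, Finset.mem_map_equiv, Equiv.symm_apply_apply]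
    rw [e]
    unfold Xor
    simp only [Finset.notMem_empty, not_false_iff, and_true, false_and, or_false]
  · intro j b
    have e : π' b ∈ w₀ (τ j) ↔ b ∈ w j := by
      rw [← hτ j, Finset.mem_map_equiv, Equiv.symm_apply_apply]
    rw [e]
    unfold Xor
    simp only [Finset.notMem_empty, not_false_iff, and_true, false_and, or_false]

end Summit.ValiantsHypothesis.ValiantsHypothesis.Theorems.BarrierLever.FiniteCheck
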